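import Summits.BirchSwinnertonDyer.BirchSwinnertonDyer.Theorems.UniversalToricDescentRoadFFMemberSaturation
import Summits.BirchSwinnertonDyer.BirchSwinnertonDyer.Theorems.CongruentShaFreeCutUnrSeriesWeierstrass
import Summits.BirchSwinnertonDyer.Rank1Residual.X11b.RouteR1IntReceptacle
import HarnessLib

/-!
# Route `UniversalToricDescent`, ♭B column (♭B′ `TwinWanFrameAtThreeMultTresT` 27401), line `membertower`:
# DESCENT of «`x ∈ (y) + (p^n)`» along `R₀⟦T⟧ → S⟦T⟧` for a `μ = 0` series `y`, by `p`-saturation (no flatness) —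
# in particular along `Λ_{R₀} = R₀⟦T⟧ → 𝓞_{ℂ_p}⟦T⟧`, the receptacle of the typed weight-`k` BDP frames

Cell `bsd-wall` (run/shared/lean/pub/bsd-wall/), seat `bsd-wall-utd-p2` (lead prover g13, 2026-08-28);
`--supports stmt-BirchSwinnertonDyer-27401 --as helper`; Theses-free.

§1 Over commutative rings `R → S` (`c`), with `π ∈ R` such that `c π` is a non-zero-divisor on `S` and `c` REFLECTS divisibility
by `π` (`c x ∈ (c π) → x ∈ (π)`): for `y = X^s·V + C π·Q ∈ R⟦X⟧` with `V` a unit, membership in `(y) + (π^n)` DESCENDS —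
`map c x ∈ (map c y) + (C (c π)^n)` implies `x ∈ (y) + (C π^n)` (`mem_span_sup_of_map_mem_span_sup`; induction on `n`: the
step peels one `π` off by `p`-saturation of `map c y` (p628881 `dvd_of_dvd_C_pow_mul_of_shape`) and the reflection of the first
`s` coefficients). §2 The instance `R₀ → 𝓞_{ℂ_p}` (`R1.unrToCpInt`, reflection by the norm: `‖x‖ ≤ p⁻¹ ⇒ p ∣ x` in the DVR
`R₀`): for `y ∈ R₀⟦T⟧` with a unit coefficient (`μ(y) = 0`) and an ideal `J ⊆ R₀⟦T⟧`,
`J·𝓞_{ℂ_p}⟦T⟧ ⊆ (y) + (p^n) ⟹ J ⊆ (y) + (p^n)` (`unrSeries_le_span_sup_of_map_le`). Complements the tree's principal-ideal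
descent `X11b.unrSeries_mem_span_singleton_of_map_mem` (value descent) with the `(y) + (p^n)` shape the member tower needs.
HONEST FRAMING: theorems only (commutative algebra and `p`-adic norms); nothing booked; BSD is proved for no curve.
References: [Washington1997] §7.1; [Castella2018] §3 (`R₀`, `𝓞_{ℂ_p}`).
-/

set_option autoImplicit false

noncomputable section

open scoped Classical

open PowerSeries Literature.NumberTheory.EllipticCurves Summit.BirchSwinnertonDyer.Rank1Residual.X2
  Summit.BirchSwinnertonDyer.Rank1Residual.X11b.Halves

namespace Summit.BirchSwinnertonDyer.Rank1Residual.X11b.RoadFFSaturation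

/-! ### §1 Generic descent of `(y) + (π^n)`-membership by saturation -/

section GenericDescent

variable {R S : Type*} [CommRing R] [CommRing S]

/-- If the first `s` coefficients of `A` lie in an ideal `J`, so do the first `s` coefficients of `A·B`. [folklore] -/
theorem coeff_mul_mem_of_coeff_mem_lt (J : Ideal S) {A : PowerSeries S} (B : PowerSeries S) (s : ℕ)
    (hA : ∀ a : ℕ, a < s → coeff a A ∈ J) (i : ℕ) (hi : i < s) : coeff i (A * B) ∈ J := by
  rw [coeff_mul]
  refine Ideal.sum_mem _ fun ab hab ↦ ?_
  have hab' : ab.1 + ab.2 = i := Finset.HasAntidiagonal.mem_antidiagonal.mp hab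
  exact J.mul_mem_right _ (hA ab.1 (by omega))

/-- The first `s` coefficients of `y = X^s·V + C π·Q` are multiples of `π`. [folklore] -/
theorem coeff_shape_mem_span_lt {π : R} {y V Q : PowerSeries R} (s : ℕ) (hy : y = X ^ s * V + C π * Q)
    (a : ℕ) (ha : a < s) : coeff a y ∈ Ideal.span {π} := by
  rw [hy, map_add, coeff_X_pow_mul', if_neg (not_le.mpr ha), zero_add, coeff_C_mul]
  exact Ideal.mem_span_singleton'.mpr ⟨coeff a Q, mul_comm _ _⟩

/-- **`w ∈ (y) + (C π)` when the first `s` coefficients of `w` are multiples of `π`** and `y = X^s·V + C π·Q` with `V` a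
unit: split `w = X^s·w′ + trunc_s w`, `X^s = (y − C π·Q)·V⁻¹`, and `trunc_s w ∈ (C π)`. [folklore] -/
theorem mem_span_sup_span_C_of_dvd_coeff_lt {π : R} {y V Q : PowerSeries R} (hV : IsUnit V) (s : ℕ)
    (hy : y = X ^ s * V + C π * Q) {w : PowerSeries R} (hw : ∀ i : ℕ, i < s → π ∣ coeff i w) :
    w ∈ Ideal.span {y} ⊔ Ideal.span {C π} := by
  obtain ⟨v, rfl⟩ := hV
  have hXs : (X : PowerSeries R) ^ s = (y - C π * Q) * ↑v⁻¹ := by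
    rw [hy, add_sub_cancel_right, mul_assoc, Units.mul_inv, mul_one]
  -- the truncation is a multiple of `C π`
  have htr : ∀ n : ℕ, π ∣ coeff n ((trunc s w : Polynomial R) : PowerSeries R) := by
    intro n
    rw [Polynomial.coeff_coe, coeff_trunc]
    split_ifs with h
    · exact hw n h
    · exact dvd_zero π
  obtain ⟨H, hH⟩ := exists_eq_C_mul_of_dvd_coeff π htr
  rw [eq_X_pow_mul_shift_add_trunc s w, hH, hXs]
  refine Ideal.add_mem _ ?_ (Ideal.mem_sup_right (Ideal.mem_span_singleton'.mpr ⟨H, mul_comm _ _⟩))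
  have : (y - C π * Q) * ↑v⁻¹ * (mk fun i ↦ coeff (i + s) w) =
      (↑v⁻¹ * mk fun i ↦ coeff (i + s) w) * y - (Q * ↑v⁻¹ * mk fun i ↦ coeff (i + s) w) * C π := by ring
  rw [this]
  exact Ideal.sub_mem _ (Ideal.mem_sup_left (Ideal.mem_span_singleton'.mpr ⟨_, rfl⟩))
    (Ideal.mem_sup_right (Ideal.mem_span_singleton'.mpr ⟨_, rfl⟩))

/-- **DESCENT OF `(y) + (π^n)`-MEMBERSHIP BY SATURATION.** Let `c : R → S`, `π ∈ R` with `c π` a non-zero-divisor on `S`, and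
suppose `c` reflects divisibility by `π` (`c x ∈ (c π) ⇒ x ∈ (π)`). Let `y = X^s·V + C π·Q ∈ R⟦X⟧` with `V` a unit. Then for
every `n` and `x ∈ R⟦X⟧`: `map c x ∈ (map c y) + (C (c π)^n)` in `S⟦X⟧` implies `x ∈ (y) + (C π^n)` in `R⟦X⟧`. Induction on
`n`: from `x = q·y + C π^n·w` (step `n`) and the level-`n+1` membership, `map c y ∣ C (c π)^n·(map c w − C (c π)·g)`, so by
`p`-saturation (p628881) `map c y ∣ map c w − C (c π)·g`; comparing the first `s` coefficients (those of `map c y` lie in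
`(c π)`) and reflecting, the first `s` coefficients of `w` lie in `(π)`, whence `w ∈ (y) + (C π)` and
`x ∈ (y) + (C π^{n+1})`. No flatness of `S⟦X⟧` over `R⟦X⟧` is used. [folklore] -/
theorem mem_span_sup_of_map_mem_span_sup {π : R} (c : R →+* S) (hS : ∀ z : S, c π * z = 0 → z = 0)
    (hc : ∀ x : R, c x ∈ Ideal.span {c π} → x ∈ Ideal.span {π})
    {y V Q : PowerSeries R} (hV : IsUnit V) (s : ℕ) (hy : y = X ^ s * V + C π * Q) :
    ∀ (n : ℕ) (x : PowerSeries R),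
      PowerSeries.map c x ∈ Ideal.span {PowerSeries.map c y} ⊔ Ideal.span {C (c π) ^ n} →
        x ∈ Ideal.span {y} ⊔ Ideal.span {C π ^ n} := by
  have hcy : PowerSeries.map c y = X ^ s * PowerSeries.map c V + C (c π) * PowerSeries.map c Q := by
    rw [hy, map_add, map_mul, map_mul, map_pow, map_X, map_C]
  have hcV : IsUnit (PowerSeries.map c V) := hV.map _
  intro n
  induction n with
  | zero =>
    intro x _
    rw [pow_zero, Ideal.span_singleton_one]
    exact Ideal.mem_sup_right Submodule.mem_top
  | succ n ih =>
    intro x hx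
    -- level `n`: `x = q·y + w·C π^n`
    have hle : Ideal.span {PowerSeries.map c y} ⊔ Ideal.span {C (c π) ^ (n + 1)} ≤
        Ideal.span {PowerSeries.map c y} ⊔ Ideal.span {C (c π) ^ n} :=
      sup_le_sup_left (Ideal.span_singleton_le_span_singleton.mpr (pow_dvd_pow _ n.le_succ)) _
    have hxn : PowerSeries.map c x ∈ Ideal.span {PowerSeries.map c y} ⊔ Ideal.span {C (c π) ^ n} := hle hx
    obtain ⟨u, hu, v, hv, huv⟩ := Submodule.mem_sup.mp (ih x hxn)
    obtain ⟨q, rfl⟩ := Ideal.mem_span_singleton'.mp hu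
    obtain ⟨w, rfl⟩ := Ideal.mem_span_singleton'.mp hv
    -- level `n+1` over `S`: `map c x = h·(map c y) + g·C (c π)^(n+1)`
    obtain ⟨u', hu', v', hv', huv'⟩ := Submodule.mem_sup.mp hx
    obtain ⟨h, rfl⟩ := Ideal.mem_span_singleton'.mp hu'
    obtain ⟨g, rfl⟩ := Ideal.mem_span_singleton'.mp hv'
    -- `map c y ∣ C (c π)^n · (map c w − C (c π)·g)`
    have hdvd : PowerSeries.map c y ∣ C (c π) ^ n * (PowerSeries.map c w - C (c π) * g) := by
      refine ⟨h - PowerSeries.map c q, ?_⟩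
      have hx' := congrArg (PowerSeries.map c) huv
      rw [map_add, map_mul, map_mul, map_pow, map_C, ← huv'] at hx'
      linear_combination hx'
    obtain ⟨h₂, hh₂⟩ := dvd_of_dvd_C_pow_mul_of_shape hS hcV s hcy n hdvd
    -- the first `s` coefficients of `w` are multiples of `π`
    have hw : ∀ i : ℕ, i < s → π ∣ coeff i w := by
      intro i hi
      have hcw : PowerSeries.map c w = PowerSeries.map c y * h₂ + C (c π) * g := by rw [← hh₂]; ring
      have hci : coeff i (PowerSeries.map c w) ∈ Ideal.span {c π} := by
        rw [hcw, map_add, coeff_C_mul]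
        refine Ideal.add_mem _ (coeff_mul_mem_of_coeff_mem_lt _ h₂ s (fun a ha ↦ ?_) i hi)
          (Ideal.mem_span_singleton'.mpr ⟨coeff i g, mul_comm _ _⟩)
        have := Ideal.mem_map_of_mem c (coeff_shape_mem_span_lt s hy a ha)
        rwa [Ideal.map_span, Set.image_singleton, ← coeff_map] at this
      rw [coeff_map] at hci
      exact Ideal.mem_span_singleton.mp (hc _ hci)
    -- conclude
    obtain ⟨u₂, hu₂, v₂, hv₂, huv₂⟩ := Submodule.mem_sup.mp (mem_span_sup_span_C_of_dvd_coeff_lt hV s hy hw)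
    obtain ⟨q', rfl⟩ := Ideal.mem_span_singleton'.mp hu₂
    obtain ⟨r', rfl⟩ := Ideal.mem_span_singleton'.mp hv₂
    rw [← huv, ← huv₂, add_mul, ← add_assoc, mul_assoc q' y, mul_comm y (C π ^ n), ← mul_assoc, ← add_mul,
      mul_assoc r', ← pow_succ']
    exact Ideal.add_mem _ (Ideal.mem_sup_left (Ideal.mem_span_singleton'.mpr ⟨_, rfl⟩))
      (Ideal.mem_sup_right (Ideal.mem_span_singleton'.mpr ⟨_, rfl⟩))

/-- Ideal form of the descent: `J·S⟦X⟧ ⊆ (map c y) + (C (c π)^n) ⟹ J ⊆ (y) + (C π^n)`. [folklore] -/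
theorem le_span_sup_of_map_le_span_sup {π : R} (c : R →+* S) (hS : ∀ z : S, c π * z = 0 → z = 0)
    (hc : ∀ x : R, c x ∈ Ideal.span {c π} → x ∈ Ideal.span {π})
    {y V Q : PowerSeries R} (hV : IsUnit V) (s : ℕ) (hy : y = X ^ s * V + C π * Q) (n : ℕ)
    {J : Ideal (PowerSeries R)}
    (hJ : J.map (PowerSeries.map c) ≤ Ideal.span {PowerSeries.map c y} ⊔ Ideal.span {C (c π) ^ n}) :
    J ≤ Ideal.span {y} ⊔ Ideal.span {C π ^ n} := fun x hx ↦
  mem_span_sup_of_map_mem_span_sup c hS hc hV s hy n x (hJ (Ideal.mem_map_of_mem _ hx))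

end GenericDescent

/-! ### §2 The instance `Λ_{R₀} = R₀⟦T⟧ → 𝓞_{ℂ_p}⟦T⟧` -/

section CpInt

open Summit.BirchSwinnertonDyer.BirchSwinnertonDyer.Theorems.CongruentShaFreeCutUnrSeriesWeierstrass

variable {p : ℕ} [Fact p.Prime]

/-- `𝓞_{ℂ_p}` is `p`-torsion-free (a domain in characteristic `0`). [folklore] -/
theorem eq_zero_of_unrToCpInt_p_mul_eq_zero (z : 𝓞_ℂ_[p])
    (hz : R1.unrToCpInt p ((p : ℕ) : unrIntegers p) * z = 0) : z = 0 := by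
  rcases mul_eq_zero.mp hz with h | h
  · exfalso
    have h' := congrArg (fun t : 𝓞_ℂ_[p] ↦ (t : ℂ_[p])) h
    simp only [map_natCast, ZeroMemClass.coe_zero, SubringClass.coe_natCast] at h'
    exact (Nat.cast_ne_zero.mpr (Fact.out : p.Prime).ne_zero) h'
  · exact h

/-- **`R₀ → 𝓞_{ℂ_p}` reflects divisibility by `p`**: if `x ∈ R₀` becomes a multiple of `p` in `𝓞_{ℂ_p}` then `‖x‖ ≤ p⁻¹`,
so `p ∣ x` in the DVR `R₀` (`mem_span_pow_of_norm_le`). [cite: SerreLocalFields1979, Ch. II §5, Thm. 3] -/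
theorem mem_span_p_of_unrToCpInt_mem (x : unrIntegers p)
    (hx : R1.unrToCpInt p x ∈ Ideal.span {R1.unrToCpInt p ((p : ℕ) : unrIntegers p)}) :
    x ∈ Ideal.span {((p : ℕ) : unrIntegers p)} := by
  obtain ⟨z, hz⟩ := Ideal.mem_span_singleton'.mp hx
  have hnorm : ‖(x : ℂ_[p])‖ ≤ ((p : ℝ)⁻¹) ^ 1 := by
    have h' := congrArg (fun t : 𝓞_ℂ_[p] ↦ (t : ℂ_[p])) hz
    simp only [MulMemClass.coe_mul, R1.coe_unrToCpInt, map_natCast, SubringClass.coe_natCast] at h'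
    rw [← h', norm_mul, Literature.NumberTheory.LFunctions.Dwork.norm_natCast_p_padicComplex, pow_one]
    calc ‖(z : ℂ_[p])‖ * (p : ℝ)⁻¹ ≤ 1 * (p : ℝ)⁻¹ := by
          gcongr
          exact R1.norm_coe_padicComplexInt_le_one p z
      _ = (p : ℝ)⁻¹ := one_mul _
  have := mem_span_pow_of_norm_le hnorm
  rwa [pow_one] at this

/-- **DESCENT ALONG `R₀⟦T⟧ → 𝓞_{ℂ_p}⟦T⟧` for a `μ = 0` series.** If `y ∈ R₀⟦T⟧` has a unit coefficient then for every
`n` and every ideal `J ⊆ R₀⟦T⟧`: `J·𝓞_{ℂ_p}⟦T⟧ ⊆ (y) + (p^n)` implies `J ⊆ (y) + (p^n)` (ideals of `R₀⟦T⟧`; `p^n` spelled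
`C p^n`). §1 with the shape `y = X^s·V + C p·Q` of p628881 `exists_shape_of_isUnit_coeff`.
[cite: Washington1997, §7.1] [cite: Castella2018, §3 (arXiv:1704.06608 p. 9)] -/
theorem unrSeries_le_span_sup_of_map_le {y : UnrSeries p} (hy : ∃ i : ℕ, IsUnit (coeff i y)) (n : ℕ)
    {J : Ideal (UnrSeries p)}
    (hJ : J.map (PowerSeries.map (R1.unrToCpInt p)) ≤
      Ideal.span {PowerSeries.map (R1.unrToCpInt p) y} ⊔
        Ideal.span {C (R1.unrToCpInt p ((p : ℕ) : unrIntegers p)) ^ n}) :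
    J ≤ Ideal.span {y} ⊔ Ideal.span {C ((p : ℕ) : unrIntegers p) ^ n} := by
  obtain ⟨s, V, Q, hV, hshape⟩ := exists_shape_of_isUnit_coeff hy
  exact le_span_sup_of_map_le_span_sup (R1.unrToCpInt p) eq_zero_of_unrToCpInt_p_mul_eq_zero
    mem_span_p_of_unrToCpInt_mem hV s hshape n hJ

/-- The same with `p^n` spelled as a natural-number cast in `𝓞_{ℂ_p}⟦T⟧` and as `(C p)^n` in `R₀⟦T⟧` (the consumers' spelling).
[cite: Washington1997, §7.1] -/
theorem unrSeries_le_span_sup_of_map_le' {y : UnrSeries p} (hy : ∃ i : ℕ, IsUnit (coeff i y)) (n : ℕ)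
    {J : Ideal (UnrSeries p)}
    (hJ : J.map (PowerSeries.map (R1.unrToCpInt p)) ≤
      Ideal.span {PowerSeries.map (R1.unrToCpInt p) y} ⊔ Ideal.span {((p : ℕ) : PowerSeries 𝓞_ℂ_[p]) ^ n}) :
    J ≤ Ideal.span {y} ⊔ Ideal.span {(C ((p : ℕ) : unrIntegers p) : UnrSeries p)} ^ n := by
  rw [Ideal.span_singleton_pow]
  refine unrSeries_le_span_sup_of_map_le hy n ?_
  rwa [map_natCast, map_natCast]

end CpInt

end Summit.BirchSwinnertonDyer.Rank1Residual.X11b.RoadFFSaturation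

end
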